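import Mathlib.Analysis.Distribution.TemperedDistribution
import Mathlib.Algebra.Order.Archimedean.Basic
import Literature.Analysis.FunctionSpaces.SchwartzComplete
import Literature.Analysis.FunctionSpaces.GaussianSchwartz
import HarnessLib

/-!
# Functions integrable against every Schwartz function are polynomially integrable

Topic `Analysis/FunctionSpaces`; support file (everything proved, no new definition) for the
passage from the *representation predicate* of a vector field by a tempered distribution
(`Literature.Analysis.FluidPDE.IsDistributionOf u₀ U`: `θ • u₀ ∈ L¹` and `U θ = ∫ θ • u₀` for every
Schwartz `θ`) to Koch–Tataru's *temperedness* hypothesis `(1 + ‖y‖²)^{-N} u₀ ∈ L¹` for some `N`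
(Koch–Tataru, Adv. Math. 157 (2001), Theorem 1: "Let `u` be a tempered distribution"; the tree's
`Literature.Analysis.FunctionSpaces.memBMOInv_iff_carleson_heat`, hypothesis `htemp`).

**Theorem** (`exists_integrable_inv_one_add_norm_sq_pow_mul_norm`). Let `E` be a finite-dimensional
real inner product space with its Haar volume and `w : E → W` a function into a complex normed
space such that `θ • w ∈ L¹(E)` for *every* Schwartz function `θ ∈ 𝓢(E, ℂ)`. Then there is `N : ℕ`
with `(1 + ‖y‖²)^{-N} ‖w y‖ ∈ L¹(E)`.

This is the classical remark that a locally integrable function which is "absolutely" a tempered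
distribution has polynomially bounded mass on balls (e.g. Vladimirov, *Methods of the Theory of
Generalized Functions* (2002), §5.4, or any proof that `𝒮'` consists of derivatives of slowly
growing functions); no countable family of test functions can detect it, and the proof is a
genuine application of the **uniform boundedness principle on the Fréchet space `𝓢(E, ℂ)`**
(Rudin, *Functional Analysis*, Thm. 2.6 with Thm. 7.4 (a); in the tree:
`Literature.Analysis.FunctionSpaces.barrelledSpace_schwartzMap` of `SchwartzComplete.lean` and
Mathlib's `WithSeminorms.banach_steinhaus`).

## The proof

* `w` is a.e.-strongly measurable and `‖w‖` is integrable on every ball (test with the Gaussian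
  `e^{-‖x‖²}`, which is bounded below on balls);
* the truncations `Λ_n θ = ∫_{B(0,n)} θ ‖w‖` are tempered distributions (`1_{B(0,n)} ‖w‖ ∈ L¹`,
  Mathlib's `MeasureTheory.Lp.toTemperedDistribution`), pointwise bounded on `𝓢(E, ℂ)` by
  `∫ |θ| ‖w‖ < ∞`; Banach–Steinhaus on the barrelled space `𝓢(E, ℂ)` gives a finite set `s` of
  Schwartz seminorms and `C` with `|Λ_n θ| ≤ C (s.sup p)(θ)` for all `n`, `θ`
  (`exists_seminorm_bound_setIntegral_ball`);
* testing with the Gaussians `θ_m = e^{-4^{-m}‖x‖²}` (`Literature.Analysis.FunctionSpaces.gaussianSchwartz`),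
  whose Schwartz seminorms grow at most like `4^{mM}` (`M` the largest order in `s`;
  `Literature.Analysis.FunctionSpaces.pow_mul_norm_iteratedFDeriv_exp_neg_mul_norm_sq_le`) and
  which are `≥ e⁻¹` on `B(0, 2^m)`, gives `∫_{B(0,2^m)} ‖w‖ ≤ K 4^{mM}`
  (`exists_setIntegral_ball_two_pow_le`);
* the dyadic decomposition `(1 + ‖y‖²)^{-N} ≤ Σ_m 4^N 4^{-Nm} 1_{B(0,2^m)}(y)` with `N = M + 1` sums
  to a convergent geometric series.

## References

* H. Koch, D. Tataru, *Well-posedness for the Navier–Stokes equations*, Adv. Math. 157 (2001),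
  22–35, Theorem 1 (tempered distributions in `BMO⁻¹`). [KochTataruAdvMath2001]
* W. Rudin, *Functional Analysis*, 2nd ed. (1991), Thm. 2.6 (Banach–Steinhaus), Thm. 7.4 (a)
  (`𝒮ₙ` is a Fréchet space). [Rudin1991]
-/

noncomputable section

open MeasureTheory Metric Filter Topology Set
open scoped SchwartzMap ENNReal NNReal

namespace Literature.Analysis.FunctionSpaces

variable {E : Type*} [NormedAddCommGroup E] [InnerProductSpace ℝ E] [FiniteDimensional ℝ E]
  [MeasurableSpace E] [BorelSpace E]
variable {W : Type*} [NormedAddCommGroup W] [NormedSpace ℂ W]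

/-! ## Measurability and integrability on balls -/

section Balls

/-- A function `w` with `θ • w ∈ L¹` for every Schwartz `θ` is a.e.-strongly measurable: divide
`θ • w` by the nowhere vanishing Gaussian `θ = e^{-‖x‖²}`. [folklore] -/
theorem aestronglyMeasurable_of_forall_integrable_schwartz_smul {w : E → W}
    (hw : ∀ θ : 𝓢(E, ℂ), Integrable (fun x => θ x • w x)) : AEStronglyMeasurable w volume := by
  set θ : 𝓢(E, ℂ) := gaussianSchwartz E 1 with hθ
  have hθx : ∀ x, θ x = ((Real.exp (-1 * ‖x‖ ^ 2) : ℝ) : ℂ) := fun x =>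
    gaussianSchwartz_apply one_pos x
  set g : E → ℂ := fun x => ((Real.exp (1 * ‖x‖ ^ 2) : ℝ) : ℂ) with hg
  have hgc : Continuous g := by
    rw [hg]
    fun_prop
  have hgθ : ∀ x, g x * θ x = 1 := fun x => by
    rw [hθx, hg]
    push_cast
    rw [← Complex.exp_add]
    convert Complex.exp_zero using 2
    ring
  have h2 : AEStronglyMeasurable (fun x => g x • (θ x • w x)) volume :=
    hgc.aestronglyMeasurable.smul (hw θ).1
  refine h2.congr (Eventually.of_forall fun x => ?_)
  simp only [smul_smul, hgθ x, one_smul]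

/-- A function `w` with `θ • w ∈ L¹` for every Schwartz `θ` has `‖w‖` integrable on every ball:
on `B(0, R)` the Gaussian `e^{-‖x‖²}` is at least `e^{-R²}`. [folklore] -/
theorem integrableOn_norm_ball_of_forall_integrable_schwartz_smul {w : E → W}
    (hw : ∀ θ : 𝓢(E, ℂ), Integrable (fun x => θ x • w x)) (R : ℝ) :
    IntegrableOn (fun x => ‖w x‖) (ball (0 : E) R) volume := by
  set θ : 𝓢(E, ℂ) := gaussianSchwartz E 1 with hθ
  have hθx : ∀ x, θ x = ((Real.exp (-1 * ‖x‖ ^ 2) : ℝ) : ℂ) := fun x =>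
    gaussianSchwartz_apply one_pos x
  have hint : Integrable fun x => Real.exp (R ^ 2) * ‖θ x • w x‖ := ((hw θ).norm).const_mul _
  refine hint.integrableOn.mono'
    (aestronglyMeasurable_of_forall_integrable_schwartz_smul hw).norm.restrict ?_
  filter_upwards [ae_restrict_mem measurableSet_ball] with x hx
  rw [mem_ball_zero_iff] at hx
  rw [Real.norm_of_nonneg (norm_nonneg _), norm_smul, hθx, Complex.norm_real,
    Real.norm_of_nonneg (Real.exp_pos _).le]
  have h1 : 1 ≤ Real.exp (R ^ 2) * Real.exp (-1 * ‖x‖ ^ 2) := by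
    rw [← Real.exp_add]
    exact Real.one_le_exp (by nlinarith [norm_nonneg x, hx])
  calc ‖w x‖ = 1 * ‖w x‖ := (one_mul _).symm
    _ ≤ (Real.exp (R ^ 2) * Real.exp (-1 * ‖x‖ ^ 2)) * ‖w x‖ :=
        mul_le_mul_of_nonneg_right h1 (norm_nonneg _)
    _ = Real.exp (R ^ 2) * (Real.exp (-1 * ‖x‖ ^ 2) * ‖w x‖) := by ring

end Balls

/-! ## The uniform boundedness principle for the truncated functionals -/

section BanachSteinhaus

/-- **Uniform seminorm bound for the truncations `θ ↦ ∫_{B(0,n)} θ ‖w‖`** (Banach–Steinhaus on the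
Fréchet space `𝓢(E, ℂ)`, Rudin Thm. 2.6 / 7.4 (a)): if `θ • w ∈ L¹` for every Schwartz `θ`, there
are finitely many Schwartz seminorms `s` and a constant `C` with
`‖∫_{B(0,n)} θ ‖w‖‖ ≤ C (s.sup p)(θ)` for every `n : ℕ` and every `θ`. The truncations are the
tempered distributions of the `L¹` functions `1_{B(0,n)} ‖w‖`, pointwise bounded by `∫ |θ| ‖w‖`.
[cite: Rudin1991, Thm 2.6] -/
theorem exists_seminorm_bound_setIntegral_ball {w : E → W}
    (hw : ∀ θ : 𝓢(E, ℂ), Integrable (fun x => θ x • w x)) :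
    ∃ (s : Finset (ℕ × ℕ)) (C : ℝ), 0 ≤ C ∧ ∀ (n : ℕ) (θ : 𝓢(E, ℂ)),
      ‖∫ x in ball (0 : E) n, θ x * ((‖w x‖ : ℝ) : ℂ)‖ ≤
        C * (s.sup (schwartzSeminormFamily ℂ E ℂ)) θ := by
  have hmeas := aestronglyMeasurable_of_forall_integrable_schwartz_smul hw
  -- the truncations `f n = 1_{B(0,n)} ‖w‖ ∈ L¹(E; ℂ)`
  set f : ℕ → E → ℂ := fun n => (ball (0 : E) n).indicator fun x => ((‖w x‖ : ℝ) : ℂ) with hf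
  have hfi : ∀ n, Integrable (f n) := fun n => by
    rw [hf, integrable_indicator_iff measurableSet_ball]
    exact (integrableOn_norm_ball_of_forall_integrable_schwartz_smul hw n).ofReal
  have hf1 : ∀ n, MemLp (f n) 1 volume := fun n => memLp_one_iff_integrable.2 (hfi n)
  -- as tempered distributions / continuous linear functionals on `𝓢(E, ℂ)`
  set Λ : ℕ → (𝓢(E, ℂ) →L[ℂ] ℂ) := fun n =>
    (Lp.toTemperedDistribution ((hf1 n).toLp (f n)) : 𝓢(E, ℂ) →L[ℂ] ℂ) with hΛ
  have hΛ_apply : ∀ (n : ℕ) (θ : 𝓢(E, ℂ)),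
      Λ n θ = ∫ x in ball (0 : E) n, θ x * ((‖w x‖ : ℝ) : ℂ) := by
    intro n θ
    have h1 : Λ n θ = ∫ x, θ x • (((hf1 n).toLp (f n) : Lp ℂ 1 (volume : Measure E)) : E → ℂ) x :=
      Lp.toTemperedDistribution_apply _ θ
    rw [h1, ← integral_indicator measurableSet_ball]
    refine integral_congr_ae ?_
    filter_upwards [(hf1 n).coeFn_toLp] with x hx
    rw [hx, hf, smul_eq_mul]
    simp only
    rw [← Set.indicator_mul_right _ (fun x => θ x)]
  -- pointwise boundedness: `‖Λ n θ‖ ≤ ∫ ‖θ • w‖`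
  have hbdd : ∀ (n : ℕ) (θ : 𝓢(E, ℂ)), ‖Λ n θ‖ ≤ ∫ x, ‖θ x • w x‖ := by
    intro n θ
    rw [hΛ_apply]
    calc ‖∫ x in ball (0 : E) n, θ x * ((‖w x‖ : ℝ) : ℂ)‖
        ≤ ∫ x in ball (0 : E) n, ‖θ x * ((‖w x‖ : ℝ) : ℂ)‖ := norm_integral_le_integral_norm _
      _ = ∫ x in ball (0 : E) n, ‖θ x • w x‖ := by
          refine integral_congr_ae (Eventually.of_forall fun x => ?_)
          simp only [norm_mul, Complex.norm_real, Real.norm_of_nonneg (norm_nonneg _), norm_smul]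
      _ ≤ ∫ x, ‖θ x • w x‖ :=
          setIntegral_le_integral (hw θ).norm (Eventually.of_forall fun x => norm_nonneg _)
  -- Banach–Steinhaus on the barrelled space `𝓢(E, ℂ)`
  have hbar : BarrelledSpace ℂ 𝓢(E, ℂ) := barrelledSpace_schwartzMap
  have hequi : UniformEquicontinuous ((↑) ∘ Λ) := by
    refine (norm_withSeminorms ℂ ℂ).banach_steinhaus (𝓕 := Λ) fun _ θ => ?_
    refine ⟨∫ x, ‖θ x • w x‖, ?_⟩
    rintro _ ⟨n, rfl⟩
    simpa only [coe_normSeminorm] using hbdd n θ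
  obtain ⟨q, hqc, hqle⟩ :=
    ((norm_withSeminorms ℂ ℂ).uniformEquicontinuous_iff_exists_continuous_seminorm
      (fun n => (Λ n : 𝓢(E, ℂ) →ₗ[ℂ] ℂ))).1 hequi 0
  obtain ⟨s, C, -, hC⟩ := Seminorm.bound_of_continuous (schwartz_withSeminorms ℂ E ℂ) q hqc
  refine ⟨s, C, C.coe_nonneg, fun n θ => ?_⟩
  rw [← hΛ_apply]
  have h1 : ‖Λ n θ‖ ≤ q θ := by
    have := hqle n θ
    simpa only [Seminorm.comp_apply, coe_normSeminorm, ContinuousLinearMap.coe_coe] using this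
  have h2 : q θ ≤ (C • s.sup (schwartzSeminormFamily ℂ E ℂ)) θ := hC θ
  rw [smul_apply, NNReal.smul_def, smul_eq_mul] at h2
  exact h1.trans h2

end BanachSteinhaus

/-! ## Gaussian tests and the growth of the mass on balls -/

section Growth

omit [FiniteDimensional ℝ E] [MeasurableSpace E] [BorelSpace E] in
/-- Schwartz seminorms of the Gaussians `e^{-a‖x‖²}`, `0 < a ≤ 1`: for a finite set `s` of indices,
`(s.sup p)(e^{-a‖·‖²}) ≤ D a^{-M}` with `M = max_{(k,n) ∈ s} (n + k)` and an explicit `D = D(s)`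
(`Literature.Analysis.FunctionSpaces.pow_mul_norm_iteratedFDeriv_exp_neg_mul_norm_sq_le`:
`‖x‖ᵏ ‖Dⁿ e^{-a‖·‖²}(x)‖ ≤ n! (max 1 a)ⁿ 2ⁿ (1 + (n+k)!/a^{n+k})`). [folklore] -/
theorem finset_sup_schwartzSeminormFamily_gaussianSchwartz_le (s : Finset (ℕ × ℕ)) {a : ℝ}
    (ha : 0 < a) (ha1 : a ≤ 1) :
    (s.sup (schwartzSeminormFamily ℂ E ℂ)) (gaussianSchwartz E a) ≤
      (∑ i ∈ s, ((i.2).factorial : ℝ) * 2 ^ i.2 * (1 + ((i.2 + i.1).factorial : ℝ))) *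
        a⁻¹ ^ (s.sup fun i => i.2 + i.1) := by
  set M : ℕ := s.sup fun i => i.2 + i.1 with hM
  set D : ℝ := ∑ i ∈ s, ((i.2).factorial : ℝ) * 2 ^ i.2 * (1 + ((i.2 + i.1).factorial : ℝ)) with hD
  have hterm : ∀ i : ℕ × ℕ, 0 ≤ ((i.2).factorial : ℝ) * 2 ^ i.2 * (1 + ((i.2 + i.1).factorial : ℝ)) :=
    fun i => by positivity
  have hD0 : 0 ≤ D := Finset.sum_nonneg fun i _ => hterm i
  have hainv : 1 ≤ a⁻¹ := one_le_inv_iff₀.2 ⟨ha, ha1⟩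
  refine Seminorm.finset_sup_apply_le (by positivity) fun i hi => ?_
  change SchwartzMap.seminorm ℂ i.1 i.2 (gaussianSchwartz E a) ≤ D * a⁻¹ ^ M
  -- the seminorm `p_{k,n}` of the Gaussian
  have hkn : i.2 + i.1 ≤ M := Finset.le_sup (f := fun i : ℕ × ℕ => i.2 + i.1) hi
  have hbound : ∀ x : E, ‖x‖ ^ i.1 * ‖iteratedFDeriv ℝ i.2 (gaussianSchwartz E a) x‖ ≤
      ((i.2).factorial : ℝ) * 2 ^ i.2 * (1 + ((i.2 + i.1).factorial : ℝ)) * a⁻¹ ^ M := by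
    intro x
    rw [coe_gaussianSchwartz ha, norm_iteratedFDeriv_ofReal_exp_neg_mul_norm_sq]
    refine (pow_mul_norm_iteratedFDeriv_exp_neg_mul_norm_sq_le ha i.1 i.2 x).trans ?_
    rw [max_eq_left ha1, one_pow, mul_one]
    have h1 : 1 + ((i.2 + i.1).factorial : ℝ) / a ^ (i.2 + i.1) ≤
        (1 + ((i.2 + i.1).factorial : ℝ)) * a⁻¹ ^ M := by
      have hpow : 1 ≤ a⁻¹ ^ M := one_le_pow₀ hainv
      have hpow' : (a ^ (i.2 + i.1))⁻¹ ≤ a⁻¹ ^ M := by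
        rw [← inv_pow]
        exact pow_le_pow_right₀ hainv hkn
      rw [div_eq_mul_inv, add_mul, one_mul]
      gcongr
    calc ((i.2).factorial : ℝ) * 2 ^ i.2 * (1 + ((i.2 + i.1).factorial : ℝ) / a ^ (i.2 + i.1))
        ≤ ((i.2).factorial : ℝ) * 2 ^ i.2 * ((1 + ((i.2 + i.1).factorial : ℝ)) * a⁻¹ ^ M) := by
          gcongr
      _ = _ := by ring
  refine (SchwartzMap.seminorm_le_bound ℂ i.1 i.2 _ (by positivity) hbound).trans ?_
  gcongr
  · exact Finset.single_le_sum (fun j _ => hterm j) hi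

/-- **Polynomial growth of the mass on dyadic balls**: if `θ • w ∈ L¹` for every Schwartz `θ`,
then `∫_{B(0, 2^m)} ‖w‖ ≤ K 4^{mM}` for some `K, M` and all `m : ℕ` (the seminorm bound of
`exists_seminorm_bound_setIntegral_ball` tested on the Gaussian `e^{-4^{-m}‖x‖²} ≥ e⁻¹` on
`B(0, 2^m)`). [folklore] -/
theorem exists_setIntegral_ball_two_pow_le {w : E → W}
    (hw : ∀ θ : 𝓢(E, ℂ), Integrable (fun x => θ x • w x)) :
    ∃ (K : ℝ) (M : ℕ), 0 ≤ K ∧ ∀ m : ℕ,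
      ∫ x in ball (0 : E) ((2 : ℝ) ^ m), ‖w x‖ ≤ K * ((4 : ℝ) ^ m) ^ M := by
  obtain ⟨s, C, hC0, hC⟩ := exists_seminorm_bound_setIntegral_ball hw
  set M : ℕ := s.sup fun i => i.2 + i.1 with hM
  set D : ℝ := ∑ i ∈ s, ((i.2).factorial : ℝ) * 2 ^ i.2 * (1 + ((i.2 + i.1).factorial : ℝ)) with hD
  have hD0 : 0 ≤ D := Finset.sum_nonneg fun i _ => by positivity
  refine ⟨Real.exp 1 * (C * D), M, by positivity, fun m => ?_⟩
  -- the Gaussian test `θ = e^{-a‖x‖²}`, `a = 4^{-m}`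
  set a : ℝ := ((4 : ℝ) ^ m)⁻¹ with ha
  have ha0 : 0 < a := by positivity
  have ha1 : a ≤ 1 := inv_le_one_of_one_le₀ (one_le_pow₀ (by norm_num))
  set θ : 𝓢(E, ℂ) := gaussianSchwartz E a with hθ
  have hθx : ∀ x, θ x = ((Real.exp (-a * ‖x‖ ^ 2) : ℝ) : ℂ) := fun x => gaussianSchwartz_apply ha0 x
  -- the seminorm side
  have hsemi : (s.sup (schwartzSeminormFamily ℂ E ℂ)) θ ≤ D * ((4 : ℝ) ^ m) ^ M := by
    have h := finset_sup_schwartzSeminormFamily_gaussianSchwartz_le (E := E) s ha0 ha1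
    rwa [ha, inv_inv] at h
  -- the integral side: `n = 2^m`
  have hball : ball (0 : E) ((2 ^ m : ℕ) : ℝ) = ball (0 : E) ((2 : ℝ) ^ m) := by
    push_cast
    rfl
  have hwint : IntegrableOn (fun x => ‖w x‖) (ball (0 : E) ((2 : ℝ) ^ m)) volume :=
    integrableOn_norm_ball_of_forall_integrable_schwartz_smul hw _
  have hgwint : IntegrableOn (fun x => Real.exp (-a * ‖x‖ ^ 2) * ‖w x‖)
      (ball (0 : E) ((2 : ℝ) ^ m)) volume := by
    refine hwint.mono' ((Continuous.aestronglyMeasurable (by fun_prop)).mul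
      hwint.aestronglyMeasurable) (Eventually.of_forall fun x => ?_)
    rw [norm_mul, Real.norm_of_nonneg (Real.exp_pos _).le, Real.norm_of_nonneg (norm_nonneg _)]
    refine mul_le_of_le_one_left (norm_nonneg _) ?_
    rw [Real.exp_le_one_iff]
    nlinarith [sq_nonneg ‖x‖, ha0.le]
  have hint_eq : ∫ x in ball (0 : E) ((2 ^ m : ℕ) : ℝ), θ x * ((‖w x‖ : ℝ) : ℂ) =
      ((∫ x in ball (0 : E) ((2 : ℝ) ^ m), Real.exp (-a * ‖x‖ ^ 2) * ‖w x‖ : ℝ) : ℂ) := by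
    rw [hball, ← integral_complex_ofReal]
    refine integral_congr_ae (Eventually.of_forall fun x => ?_)
    dsimp only
    rw [hθx]
    push_cast
    ring
  -- lower bound of the Gaussian on the ball
  have hlow : Real.exp (-1) * ∫ x in ball (0 : E) ((2 : ℝ) ^ m), ‖w x‖ ≤
      ∫ x in ball (0 : E) ((2 : ℝ) ^ m), Real.exp (-a * ‖x‖ ^ 2) * ‖w x‖ := by
    rw [← integral_const_mul]
    refine setIntegral_mono_on (hwint.const_mul _) hgwint measurableSet_ball fun x hx => ?_
    rw [mem_ball_zero_iff] at hx
    refine mul_le_mul_of_nonneg_right (Real.exp_le_exp.2 ?_) (norm_nonneg _)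
    have hx2 : ‖x‖ ^ 2 ≤ ((2 : ℝ) ^ m) ^ 2 := pow_le_pow_left₀ (norm_nonneg _) hx.le 2
    have h4 : ((2 : ℝ) ^ m) ^ 2 = (4 : ℝ) ^ m := by
      rw [← pow_mul, mul_comm, pow_mul]
      norm_num
    have : a * ‖x‖ ^ 2 ≤ 1 := by
      calc a * ‖x‖ ^ 2 ≤ a * ((2 : ℝ) ^ m) ^ 2 := mul_le_mul_of_nonneg_left hx2 ha0.le
        _ = 1 := by rw [h4, ha, inv_mul_cancel₀ (by positivity)]
    linarith
  have hnonneg : 0 ≤ ∫ x in ball (0 : E) ((2 : ℝ) ^ m), Real.exp (-a * ‖x‖ ^ 2) * ‖w x‖ :=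
    setIntegral_nonneg measurableSet_ball fun x _ => by positivity
  -- combine
  have hmain := hC (2 ^ m) θ
  rw [hint_eq, Complex.norm_real, Real.norm_of_nonneg hnonneg] at hmain
  have hfinal : Real.exp (-1) * ∫ x in ball (0 : E) ((2 : ℝ) ^ m), ‖w x‖ ≤
      C * (D * ((4 : ℝ) ^ m) ^ M) :=
    hlow.trans (hmain.trans (mul_le_mul_of_nonneg_left hsemi hC0))
  have hexp : Real.exp 1 * Real.exp (-1) = 1 := by
    rw [← Real.exp_add]
    norm_num
  calc ∫ x in ball (0 : E) ((2 : ℝ) ^ m), ‖w x‖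
      = Real.exp 1 * (Real.exp (-1) * ∫ x in ball (0 : E) ((2 : ℝ) ^ m), ‖w x‖) := by
        rw [← mul_assoc, hexp, one_mul]
    _ ≤ Real.exp 1 * (C * (D * ((4 : ℝ) ^ m) ^ M)) :=
        mul_le_mul_of_nonneg_left hfinal (Real.exp_pos _).le
    _ = Real.exp 1 * (C * D) * ((4 : ℝ) ^ m) ^ M := by ring

end Growth

/-! ## Polynomial integrability -/

section Tempered

omit [InnerProductSpace ℝ E] [FiniteDimensional ℝ E] [MeasurableSpace E] [BorelSpace E]
  [NormedSpace ℂ W] in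
/-- The dyadic comparison `(1 + ‖y‖²)^{-N} ‖w y‖ ≤ Σ_m 4^N (4^m)^{-N} 1_{B(0,2^m)}(y) ‖w y‖` in
`[0, ∞]`: one term of the series already dominates (`m = 0` if `‖y‖ < 1`, and `2^{m-1} ≤ ‖y‖ < 2^m`
otherwise). [folklore] -/
theorem ofReal_inv_one_add_norm_sq_pow_mul_norm_le_tsum (w : E → W) (N : ℕ) (y : E) :
    ENNReal.ofReal (((1 + ‖y‖ ^ 2) ^ N)⁻¹ * ‖w y‖) ≤
      ∑' m : ℕ, ENNReal.ofReal ((4 : ℝ) ^ N * (((4 : ℝ) ^ m) ^ N)⁻¹) *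
        (ball (0 : E) ((2 : ℝ) ^ m)).indicator (fun y => ‖w y‖ₑ) y := by
  -- choose the dyadic scale of `y`
  obtain ⟨m, hym, hwm⟩ : ∃ m : ℕ, ‖y‖ < (2 : ℝ) ^ m ∧
      ((1 + ‖y‖ ^ 2) ^ N)⁻¹ ≤ (4 : ℝ) ^ N * (((4 : ℝ) ^ m) ^ N)⁻¹ := by
    rcases lt_or_ge ‖y‖ 1 with hy | hy
    · refine ⟨0, by simpa using hy, ?_⟩
      simp only [pow_zero, one_pow, inv_one, mul_one]
      calc ((1 + ‖y‖ ^ 2) ^ N)⁻¹ ≤ 1 := by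
            refine inv_le_one_of_one_le₀ (one_le_pow₀ ?_)
            nlinarith [sq_nonneg ‖y‖]
        _ ≤ (4 : ℝ) ^ N := one_le_pow₀ (by norm_num)
    · obtain ⟨n, hn, hn'⟩ := exists_nat_pow_near hy one_lt_two
      refine ⟨n + 1, hn', ?_⟩
      have h4n : (0 : ℝ) < (4 : ℝ) ^ n := by positivity
      have hsq : (4 : ℝ) ^ n ≤ ‖y‖ ^ 2 := by
        have : ((2 : ℝ) ^ n) ^ 2 ≤ ‖y‖ ^ 2 := pow_le_pow_left₀ (by positivity) hn 2
        calc (4 : ℝ) ^ n = ((2 : ℝ) ^ n) ^ 2 := by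
              rw [← pow_mul, mul_comm, pow_mul]; norm_num
          _ ≤ ‖y‖ ^ 2 := this
      have h1 : ((1 + ‖y‖ ^ 2) ^ N)⁻¹ ≤ (((4 : ℝ) ^ n) ^ N)⁻¹ := by
        refine inv_anti₀ (by positivity) (pow_le_pow_left₀ h4n.le ?_ N)
        linarith
      refine h1.trans (le_of_eq ?_)
      rw [pow_succ, mul_pow, mul_inv, mul_left_comm, mul_inv_cancel₀ (by positivity), mul_one]
  -- the chosen term dominates
  refine le_trans ?_ (ENNReal.le_tsum m)
  rw [indicator_of_mem (mem_ball_zero_iff.2 hym), ← ofReal_norm,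
    ← ENNReal.ofReal_mul (by positivity)]
  exact ENNReal.ofReal_le_ofReal (mul_le_mul_of_nonneg_right hwm (norm_nonneg _))

/-- **A function integrable against every Schwartz function is polynomially integrable**
(uniform boundedness principle on the Fréchet space `𝓢(E, ℂ)`, Rudin Thm. 2.6 / 7.4 (a); this is
the temperedness hypothesis of Koch–Tataru 2001, Theorem 1, for functions given together with
their tempered distribution): if `θ • w ∈ L¹(E)` for every `θ ∈ 𝓢(E, ℂ)`, then
`(1 + ‖y‖²)^{-N} ‖w y‖ ∈ L¹(E)` for some `N : ℕ`. [cite: Rudin1991, Thm 2.6] -/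
theorem exists_integrable_inv_one_add_norm_sq_pow_mul_norm {w : E → W}
    (hw : ∀ θ : 𝓢(E, ℂ), Integrable (fun x => θ x • w x)) :
    ∃ N : ℕ, Integrable fun y : E => ((1 + ‖y‖ ^ 2) ^ N)⁻¹ * ‖w y‖ := by
  have hmeas := aestronglyMeasurable_of_forall_integrable_schwartz_smul hw
  obtain ⟨K, M, hK0, hK⟩ := exists_setIntegral_ball_two_pow_le hw
  set N : ℕ := M + 1 with hN
  refine ⟨N, ?_⟩
  have hwc : Continuous fun y : E => ((1 + ‖y‖ ^ 2) ^ N)⁻¹ :=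
    Continuous.inv₀ (by fun_prop) fun y => by positivity
  refine ⟨hwc.aestronglyMeasurable.mul hmeas.norm, ?_⟩
  have hnn : ∀ y : E, 0 ≤ ((1 + ‖y‖ ^ 2) ^ N)⁻¹ * ‖w y‖ := fun y => by positivity
  rw [hasFiniteIntegral_iff_enorm]
  simp_rw [Real.enorm_eq_ofReal (hnn _)]
  -- mass on the dyadic balls, in `[0, ∞]`
  have hball : ∀ m : ℕ, ∫⁻ y in ball (0 : E) ((2 : ℝ) ^ m), ‖w y‖ₑ ≤
      ENNReal.ofReal (K * ((4 : ℝ) ^ m) ^ M) := by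
    intro m
    have hi := integrableOn_norm_ball_of_forall_integrable_schwartz_smul hw ((2 : ℝ) ^ m)
    have h1 : ∫⁻ y in ball (0 : E) ((2 : ℝ) ^ m), ‖w y‖ₑ =
        ∫⁻ y in ball (0 : E) ((2 : ℝ) ^ m), ‖(fun y => ‖w y‖) y‖ₑ := by
      simp only [enorm_norm]
    rw [h1, ← ofReal_integral_norm_eq_lintegral_enorm hi]
    refine ENNReal.ofReal_le_ofReal ?_
    simpa only [norm_norm] using hK m
  -- the main estimate
  have hq : ENNReal.ofReal (4⁻¹ : ℝ) < 1 := by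
    rw [← ENNReal.ofReal_one]
    exact (ENNReal.ofReal_lt_ofReal_iff one_pos).2 (by norm_num)
  calc ∫⁻ y, ENNReal.ofReal (((1 + ‖y‖ ^ 2) ^ N)⁻¹ * ‖w y‖)
      ≤ ∫⁻ y, ∑' m : ℕ, ENNReal.ofReal ((4 : ℝ) ^ N * (((4 : ℝ) ^ m) ^ N)⁻¹) *
          (ball (0 : E) ((2 : ℝ) ^ m)).indicator (fun y => ‖w y‖ₑ) y :=
        lintegral_mono fun y => ofReal_inv_one_add_norm_sq_pow_mul_norm_le_tsum w N y
    _ = ∑' m : ℕ, ENNReal.ofReal ((4 : ℝ) ^ N * (((4 : ℝ) ^ m) ^ N)⁻¹) *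
          ∫⁻ y in ball (0 : E) ((2 : ℝ) ^ m), ‖w y‖ₑ := by
        rw [lintegral_tsum fun m => ?_]
        · congr 1
          funext m
          rw [lintegral_const_mul' _ _ ENNReal.ofReal_ne_top, lintegral_indicator measurableSet_ball]
        · exact (hmeas.enorm.indicator measurableSet_ball).const_mul _
    _ ≤ ∑' m : ℕ, ENNReal.ofReal ((4 : ℝ) ^ N * (((4 : ℝ) ^ m) ^ N)⁻¹) *
          ENNReal.ofReal (K * ((4 : ℝ) ^ m) ^ M) :=
        ENNReal.tsum_le_tsum fun m => mul_le_mul' le_rfl (hball m)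
    _ = ∑' m : ℕ, ENNReal.ofReal ((4 : ℝ) ^ N * K) * ENNReal.ofReal (4⁻¹ : ℝ) ^ m := by
        congr 1
        funext m
        rw [← ENNReal.ofReal_pow (by norm_num), ← ENNReal.ofReal_mul (by positivity),
          ← ENNReal.ofReal_mul (by positivity)]
        congr 1
        rw [inv_pow, hN, pow_succ]
        field_simp
        ring
    _ < ∞ := by
        rw [ENNReal.tsum_mul_left, ENNReal.tsum_geometric]
        exact ENNReal.mul_lt_top ENNReal.ofReal_lt_top
          (ENNReal.inv_lt_top.2 (tsub_pos_of_lt hq))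

end Tempered

end Literature.Analysis.FunctionSpaces
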